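import Literature.Geometry.Lorentzian.DirectLimitMetric
import Literature.Geometry.Lorentzian.GluedTimeOrientation
import Mathlib.Geometry.Manifold.PartitionOfUnity
import Mathlib.Geometry.Manifold.VectorField.Pullback
import HarnessLib

/-!
# The time orientation of a direct limit of time-oriented Lorentzian manifolds along
# time-orientation preserving isometric open embeddings

Third layer (after `Literature.Geometry.Manifold.DirectLimitManifold` and
`Literature.Geometry.Lorentzian.DirectLimitMetric`) of the union-of-a-chain construction of
developments (Choquet-Bruhat–Geroch, Comm. Math. Phys. 14 (1969), proof of Thm. 3, p. 333;
`Literature.Geometry.Lorentzian.CauchyProblemMGHDExistenceProofs`, § "What remains", item (a)).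
If the pieces `obj i` of a smooth directed system `d` along injective local diffeomorphisms carry
time-oriented Lorentzian metrics `(gL i, τ i)` and the transition maps are time-orientation
preserving isometric immersions, then the limit Lorentzian manifold
`(d.Limit, d.limitLorentzianMetric gL hgL)` carries a time orientation for which every canonical map
`incl i` preserves the time orientation (`d.exists_limitTimeOrientation`, `d.limitTimeOrientation`,
`d.preservesTimeOrientation_incl`).

As for the gluing of two developments (Sbierski 2016, §3.3: *"we can consistently single out a
future direction at each point of `M̃` … since this is a local property, this follows
immediately"*; `Literature.Geometry.Lorentzian.GluedTimeOrientation`), the tree's time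
orientations being smooth timelike vector FIELDS (O'Neill 1983, Ch. 5, Lemma 5.32), the
consistent cone field is turned into a vector field by a partition of unity: the future timecones
`t z = {v timelike | g̃(R z, v) < 0}` of the pushed-forward orienting vectors `R z` (of a chosen
piece through `z`) form a convex-valued family (`LorentzianMetric.convex_timecone`) whose members do
not depend on the piece (`val_pushforward_neg`: two pieces through `z` lie below a common one,
whose transition maps preserve the time orientation), with the smooth local sections
`z ↦ d(incl i)(T_i((incl i)⁻¹ z))` — Mathlib's `VectorField.mpullback` of `T_i` along the smooth
inverse `(incl i)⁻¹` (`contMDiffAt_mpullback_inclSymm`, `ContMDiffAt.mpullback_vectorField_preimage`)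
— so that `exists_contMDiffSection_forall_mem_convex_of_local` applies on the σ-compact limit
(second countable by Geroch's theorem, `d.secondCountableTopology_limit_of_lorentzian`, BEFORE the
time orientation exists).

* `d.isInvertible_mfderiv_inclSymm`, `d.mpullback_inclSymm_incl`, `d.contMDiffAt_mpullback_inclSymm`;
* `d.val_mfderiv_incl` (isometry identity of `incl i`), `d.mfderiv_incl_eq_comp` (chain rule
  through a later piece), `d.val_pushforward_neg` (cone compatibility);
* `d.exists_limitTimeOrientation`, `d.limitTimeOrientation`, `d.preservesTimeOrientation_incl`.

## References

* Y. Choquet-Bruhat, R. Geroch, Comm. Math. Phys. 14 (1969) 329–335, proof of Thm. 3, p. 333.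
  [ChoquetBruhatGeroch1969CMP]
* J. Sbierski, Ann. Henri Poincaré 17 (2016) 301–329 = arXiv:1309.7591v3, §3.3, proof of Thm. 5
  (time orientation step). [Sbierski2016AHP]
* B. O'Neill, *Semi-Riemannian geometry* (1983), Ch. 5, Lemma 5.29, Lemma 5.32, p. 145.
  [ONeill1983]
-/

open scoped Manifold ContDiff Topology
open Bundle Set Function Filter _root_.Topology VectorField

noncomputable section

namespace Literature.Geometry.Manifold

namespace SmoothDirectLimitData

open Literature.Geometry.Lorentzian Literature.Geometry.Lorentzian.PseudoRiemannianMetric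

universe u v w

variable {E : Type v} [NormedAddCommGroup E] [NormedSpace ℝ E] {ι : Type w} [Preorder ι]
  [IsDirectedOrder ι] (d : SmoothDirectLimitData.{u, v, w} E ι)

/-! ### The push-forward of vector fields of the pieces -/

/-- The differential of `(incl i)⁻¹` at a point of the image is invertible, with inverse the
differential of `incl i`. [folklore] -/
theorem isInvertible_mfderiv_inclSymm (i : ι) {z : d.Limit} (hz : z ∈ range (d.incl i)) :
    (mfderiv 𝓘(ℝ, E) 𝓘(ℝ, E) (d.inclSymm i) z).IsInvertible := by
  obtain ⟨x, rfl⟩ := hz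
  have h1 := d.mfderiv_incl_comp_mfderiv_inclSymm i x
  have h2 := d.mfderiv_inclSymm_comp_mfderiv_incl i x
  refine ⟨ContinuousLinearEquiv.equivOfInverse (mfderiv 𝓘(ℝ, E) 𝓘(ℝ, E) (d.inclSymm i) (d.incl i x))
    (mfderiv 𝓘(ℝ, E) 𝓘(ℝ, E) (d.incl i) x) (fun v ↦ ?_) (fun v ↦ ?_), rfl⟩
  · exact DFunLike.congr_fun h1 v
  · exact DFunLike.congr_fun h2 v

/-- **The push-forward along `incl i` as a pullback along `(incl i)⁻¹`**: for a vector field `V`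
of the piece, `((incl i)⁻¹)^* V (incl i x) = d(incl i)_x (V x)`. [folklore] -/
theorem mpullback_inclSymm_incl (i : ι) (V : Π y : d.obj i, TangentSpace 𝓘(ℝ, E) y) (x : d.obj i) :
    mpullback 𝓘(ℝ, E) 𝓘(ℝ, E) (d.inclSymm i) V (d.incl i x) =
      mfderiv 𝓘(ℝ, E) 𝓘(ℝ, E) (d.incl i) x (V x) := by
  rw [mpullback_apply]
  refine ((d.isInvertible_mfderiv_inclSymm i ⟨x, rfl⟩).inverse_apply_eq).2 ?_
  rw [inclSymm_incl]
  exact (DFunLike.congr_fun (d.mfderiv_inclSymm_comp_mfderiv_incl i x) (V x)).symm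

/-- Chain rule through a later piece: `d(incl i)_x = d(incl k)_{φ x} ∘ d(φ_{ik})_x`. [folklore] -/
theorem mfderiv_incl_eq_comp {i k : ι} (hik : i ≤ k) (x : d.obj i) :
    mfderiv 𝓘(ℝ, E) 𝓘(ℝ, E) (d.incl i) x =
      (mfderiv 𝓘(ℝ, E) 𝓘(ℝ, E) (d.incl k) (d.map i k hik x)).comp
        (mfderiv 𝓘(ℝ, E) 𝓘(ℝ, E) (d.map i k hik) x) := by
  have hfun : d.incl i = d.incl k ∘ d.map i k hik := funext fun y ↦ (d.incl_map hik y).symm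
  rw [hfun]
  exact mfderiv_comp x (((d.contMDiff_incl k) _).mdifferentiableAt (by simp))
    (((d.isLocalDiffeomorph i k hik).contMDiff x).mdifferentiableAt (by simp))

/-- **The push-forward of a smooth vector field of a piece is smooth on the image of the piece**
(as a section of the tangent bundle of the limit): it is the pullback along the smooth local
diffeomorphism `(incl i)⁻¹` (`ContMDiffAt.mpullback_vectorField_preimage`). [folklore] -/
theorem contMDiffAt_mpullback_inclSymm [CompleteSpace E] (i : ι)
    {V : Π y : d.obj i, TangentSpace 𝓘(ℝ, E) y}
    (hV : ContMDiff 𝓘(ℝ, E) 𝓘(ℝ, E).tangent ∞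
      (fun y ↦ (TotalSpace.mk' E y (V y) : TangentBundle 𝓘(ℝ, E) (d.obj i))))
    {z : d.Limit} (hz : z ∈ range (d.incl i)) :
    ContMDiffAt 𝓘(ℝ, E) 𝓘(ℝ, E).tangent ∞
      (fun z ↦ (TotalSpace.mk' E z (mpullback 𝓘(ℝ, E) 𝓘(ℝ, E) (d.inclSymm i) V z) :
        TangentBundle 𝓘(ℝ, E) d.Limit)) z :=
  ContMDiffAt.mpullback_vectorField_preimage (hV _) (d.contMDiffAt_inclSymm i hz)
    (d.isInvertible_mfderiv_inclSymm i hz) le_rfl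

/-! ### Cone compatibility -/

variable [FiniteDimensional ℝ E] (gL : ∀ i, LorentzianMetric 𝓘(ℝ, E) ∞ (d.obj i))
  (hgL : ∀ i j (h : i ≤ j), (gL i).IsIsometricImmersion (gL j).toPseudoRiemannianMetric (d.map i j h))
  (τ : ∀ i, TimeOrientation (gL i))
  (hτ : ∀ i j (h : i ≤ j), (τ i).PreservesTimeOrientation (d.map i j h) (τ j))

/-- The isometry identity of the canonical maps:
`g̃(d(incl i) u, d(incl i) w) = g_i(u, w)`. [cite: ChoquetBruhatGeroch1969CMP, proof of Thm. 3 (p. 333)] -/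
theorem val_mfderiv_incl (i : ι) (x : d.obj i) (u w : TangentSpace 𝓘(ℝ, E) x) :
    (d.limitLorentzianMetric gL hgL).val (d.incl i x) (mfderiv 𝓘(ℝ, E) 𝓘(ℝ, E) (d.incl i) x u)
      (mfderiv 𝓘(ℝ, E) 𝓘(ℝ, E) (d.incl i) x w) = (gL i).val x u w := by
  have h := (d.isIsometricImmersion_incl (fun i ↦ (gL i).toPseudoRiemannianMetric) hgL i).2 x
  have := DFunLike.congr_fun (DFunLike.congr_fun h u) w
  rw [pullbackBilin_apply] at this
  exact this

/-- The isometry identity of the canonical maps, based at any presentation of the point.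
[folklore] -/
theorem val_mfderiv_incl' (i : ι) (x : d.obj i) {z : d.Limit} (hz : d.incl i x = z)
    (u w : TangentSpace 𝓘(ℝ, E) x) :
    (d.limitLorentzianMetric gL hgL).val z (mfderiv 𝓘(ℝ, E) 𝓘(ℝ, E) (d.incl i) x u)
      (mfderiv 𝓘(ℝ, E) 𝓘(ℝ, E) (d.incl i) x w) = (gL i).val x u w := by
  subst hz
  exact d.val_mfderiv_incl gL hgL i x u w

include hτ in
/-- **Cone compatibility**: if `incl i x = incl j y = z` and `v ∈ T_x` is future-directed for
`τ i`, then `d(incl j)(T_j y)` and `d(incl i) v` lie in one timecone of the limit: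
`g̃(d(incl j) T_j(y), d(incl i) v) < 0`. Both are images under `d(incl k)` of `τ k`-future vectors
of a common later piece `k` (the transition maps preserve the time orientation,
`PreservesTimeOrientation.isFutureDirected_mfderiv`), and two future causal vectors, one of them
timelike, have negative scalar product (`LorentzianMetric.val_lt_zero_of_isCausal`).
[cite: Sbierski2016AHP, §3.3, proof of Thm. 5 (time orientation step)] -/
theorem val_pushforward_neg {i j : ι} {x : d.obj i} {y : d.obj j} {z : d.Limit}
    (hx : d.incl i x = z) (hy : d.incl j y = z) {v : TangentSpace 𝓘(ℝ, E) x}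
    (hv : (τ i).IsFutureDirected v) :
    (d.limitLorentzianMetric gL hgL).val z
      (mfderiv 𝓘(ℝ, E) 𝓘(ℝ, E) (d.incl j) y ((τ j).vectorField y))
      (mfderiv 𝓘(ℝ, E) 𝓘(ℝ, E) (d.incl i) x v) < 0 := by
  subst hx
  obtain ⟨k, hik, hjk⟩ := exists_ge_ge i j
  have hxy : d.map i k hik x = d.map j k hjk y := (d.incl_eq_incl_iff_of_le hik hjk).1 hy.symm
  -- pointwise chain rules through the piece `k`
  have e1 : mfderiv 𝓘(ℝ, E) 𝓘(ℝ, E) (d.incl i) x v =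
      mfderiv 𝓘(ℝ, E) 𝓘(ℝ, E) (d.incl k) (d.map i k hik x)
        (mfderiv 𝓘(ℝ, E) 𝓘(ℝ, E) (d.map i k hik) x v) :=
    DFunLike.congr_fun (d.mfderiv_incl_eq_comp hik x) v
  have e2 : mfderiv 𝓘(ℝ, E) 𝓘(ℝ, E) (d.incl j) y ((τ j).vectorField y) =
      mfderiv 𝓘(ℝ, E) 𝓘(ℝ, E) (d.incl k) (d.map j k hjk y)
        (mfderiv 𝓘(ℝ, E) 𝓘(ℝ, E) (d.map j k hjk) y ((τ j).vectorField y)) :=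
    DFunLike.congr_fun (d.mfderiv_incl_eq_comp hjk y) _
  -- in the piece `k`: two `τ k`-future vectors, the first timelike
  have h1 : (τ k).IsFutureDirected (mfderiv 𝓘(ℝ, E) 𝓘(ℝ, E) (d.map i k hik) x v) :=
    (hτ i k hik).isFutureDirected_mfderiv (τ := τ k) (hgL i k hik).2 hv
  have h2 : (τ k).IsFutureDirected
      (mfderiv 𝓘(ℝ, E) 𝓘(ℝ, E) (d.map j k hjk) y ((τ j).vectorField y)) := hτ j k hjk y
  have hT : (gL k).IsTimelike
      (mfderiv 𝓘(ℝ, E) 𝓘(ℝ, E) (d.map j k hjk) y ((τ j).vectorField y)) := by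
    have key := DFunLike.congr_fun (DFunLike.congr_fun ((hgL j k hjk).2 y) ((τ j).vectorField y))
      ((τ j).vectorField y)
    rw [pullbackBilin_apply] at key
    rw [LorentzianMetric.isTimelike_iff, key]
    exact (τ j).isTimelike y
  -- the timecone lemma in the piece `k`, transported by the isometry `incl k`
  have key : ∀ {p q : d.obj k} (hqp : q = p) {a : TangentSpace 𝓘(ℝ, E) q}
      {b : TangentSpace 𝓘(ℝ, E) p}, (τ k).IsFutureDirected a → (gL k).IsTimelike a →
      (τ k).IsFutureDirected b → ∀ {z : d.Limit}, d.incl k p = z →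
      (d.limitLorentzianMetric gL hgL).val z (mfderiv 𝓘(ℝ, E) 𝓘(ℝ, E) (d.incl k) q a)
        (mfderiv 𝓘(ℝ, E) 𝓘(ℝ, E) (d.incl k) p b) < 0 := by
    intro p q hqp a b ha hat hb z hz
    subst hqp
    subst hz
    rw [val_mfderiv_incl]
    exact (gL k).val_lt_zero_of_isCausal ((τ k).isTimelike _) hat ha.2 hb.1 hb.2
  rw [e1, e2]
  exact key hxy.symm h2 hT h1 (d.incl_map hik x)

/-! ### The time orientation -/

include hτ in
/-- **A direct limit of time-oriented Lorentzian manifolds along time-orientation preserving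
isometric open embeddings is time-orientable, compatibly with the pieces**: there is a time
orientation of `(lim obj, g̃)` for which every `incl i` preserves the time orientation. The
future timecones of the pushed-forward orienting vectors form a convex cone field with smooth local
sections (the pushed-forward fields `((incl i)⁻¹)^* T_i`), hence admit a smooth global section by a
partition of unity on the σ-compact limit (`exists_contMDiffSection_forall_mem_convex_of_local`).
[cite: ChoquetBruhatGeroch1969CMP, proof of Thm. 3 (p. 333)]
[cite: Sbierski2016AHP, §3.3, proof of Thm. 5 (time orientation step)] -/
theorem exists_limitTimeOrientation [Nonempty ι] [∀ i, T2Space (d.obj i)]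
    [∀ i, ConnectedSpace (d.obj i)] :
    ∃ T : TimeOrientation (d.limitLorentzianMetric gL hgL),
      ∀ i, (τ i).PreservesTimeOrientation (d.incl i) T := by
  classical
  haveI : SecondCountableTopology d.Limit := d.secondCountableTopology_limit_of_lorentzian gL hgL
  haveI : LocallyCompactSpace d.Limit := ChartedSpace.locallyCompactSpace (H := E) (M := d.Limit)
  set g := d.limitLorentzianMetric gL hgL with hg
  -- chosen representatives and the reference (pushed-forward orienting) vectors
  set c : d.Limit → ι := fun z ↦ Classical.choose (d.exists_eq_incl z) with hc
  set xc : ∀ z : d.Limit, d.obj (c z) := fun z ↦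
    Classical.choose (Classical.choose_spec (d.exists_eq_incl z)) with hxc
  have hzc : ∀ z, d.incl (c z) (xc z) = z := fun z ↦
    (Classical.choose_spec (Classical.choose_spec (d.exists_eq_incl z))).symm
  set F : ∀ (i : ι), d.obj i → E := fun i x ↦
    mfderiv 𝓘(ℝ, E) 𝓘(ℝ, E) (d.incl i) x ((τ i).vectorField x) with hF
  have hFt : ∀ i x, g.IsTimelike (x := d.incl i x) (F i x) := fun i x ↦ by
    change g.val (d.incl i x) (F i x) (F i x) < 0
    rw [hF, hg, val_mfderiv_incl]
    exact (τ i).isTimelike x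
  set R : ∀ z : d.Limit, TangentSpace 𝓘(ℝ, E) z := fun z ↦ F (c z) (xc z) with hR
  have hRt : ∀ z, g.IsTimelike (R z) := fun z ↦ by
    have h := hFt (c z) (xc z)
    rw [hzc z] at h
    exact h
  -- the cone field and its convexity
  let t : ∀ z : d.Limit, Set (TangentSpace 𝓘(ℝ, E) z) := fun z ↦
    {v | g.IsTimelike v ∧ g.val z (R z) v < 0}
  have ht_conv : ∀ z, Convex ℝ (t z) := fun z ↦ g.convex_timecone (hRt z)
  -- the pushed-forward fields lie in the cones
  have hFR : ∀ i x, g.val (d.incl i x) (R (d.incl i x)) (F i x) < 0 := fun i x ↦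
    d.val_pushforward_neg gL hgL τ hτ rfl (hzc (d.incl i x)) ((τ i).isFutureDirected_vectorField x)
  -- local smooth sections
  have Hloc : ∀ z₀ : d.Limit, ∃ U ∈ 𝓝 z₀, ∃ s : Π z : d.Limit, TangentSpace 𝓘(ℝ, E) z,
      ContMDiffOn 𝓘(ℝ, E) 𝓘(ℝ, E).tangent ∞
        (fun z ↦ (TotalSpace.mk' E z (s z) : TangentBundle 𝓘(ℝ, E) d.Limit)) U ∧
        ∀ z ∈ U, s z ∈ t z := by
    intro z₀
    obtain ⟨i, x₀, rfl⟩ := d.exists_eq_incl z₀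
    refine ⟨range (d.incl i), (d.isOpen_range_incl i).mem_nhds ⟨x₀, rfl⟩,
      mpullback 𝓘(ℝ, E) 𝓘(ℝ, E) (d.inclSymm i) (τ i).vectorField,
      fun z hz ↦ (d.contMDiffAt_mpullback_inclSymm i (τ i).contMDiff hz).contMDiffWithinAt, ?_⟩
    rintro _ ⟨x, rfl⟩
    rw [mem_setOf_eq, mpullback_inclSymm_incl]
    exact ⟨hFt i x, hFR i x⟩
  obtain ⟨s, hs⟩ := exists_contMDiffSection_forall_mem_convex_of_local (n := (⊤ : ℕ∞)) 𝓘(ℝ, E)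
    (TangentSpace 𝓘(ℝ, E) : d.Limit → Type _) t ht_conv Hloc
  refine ⟨⟨s, fun z ↦ (hs z).1, s.contMDiff⟩, fun i x ↦ ?_⟩
  -- `d(incl i) T_i` is future-directed: `s` and `F i x` both lie in the cone of `R (incl i x)`
  refine ⟨(hFt i x).isCausal, ?_⟩
  change g.val (d.incl i x) (s (d.incl i x)) (F i x) < 0
  exact g.val_lt_zero_of_isCausal (hRt _) (hs _).1 (hs _).2 (hFt i x).isCausal (hFR i x)

/-- **The time orientation of the direct limit** (a choice from `exists_limitTimeOrientation`).
[cite: ChoquetBruhatGeroch1969CMP, proof of Thm. 3 (p. 333)] -/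
def limitTimeOrientation [Nonempty ι] [∀ i, T2Space (d.obj i)] [∀ i, ConnectedSpace (d.obj i)] :
    TimeOrientation (d.limitLorentzianMetric gL hgL) :=
  Classical.choose (d.exists_limitTimeOrientation gL hgL τ hτ)

/-- **The canonical maps preserve the time orientation of the limit.**
[cite: ChoquetBruhatGeroch1969CMP, proof of Thm. 3 (p. 333)] -/
theorem preservesTimeOrientation_incl [Nonempty ι] [∀ i, T2Space (d.obj i)]
    [∀ i, ConnectedSpace (d.obj i)] (i : ι) :
    (τ i).PreservesTimeOrientation (d.incl i) (d.limitTimeOrientation gL hgL τ hτ) :=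
  Classical.choose_spec (d.exists_limitTimeOrientation gL hgL τ hτ) i

end SmoothDirectLimitData

end Literature.Geometry.Manifold

end
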